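import Literature.NumberTheory.Automorphic.AutomorphicCohomologyGLnCoeff
import Literature.NumberTheory.Automorphic.CuspidalCohomologyHeckeEigenvalue
import Literature.NumberTheory.Automorphic.UnramifiedLevelChange
import HarnessLib

/-!
# Hecke operators on `H^q(𝔤, K_∞; π ⊗ E)^{K_f(𝔫)}` act by the Satake scalars at every `w ∤ 𝔫`
# (any coefficient `(𝔤, K_∞)`-module `E`)

Topic `NumberTheory/Automorphic`; namespace `Literature.NumberTheory.Automorphic.AutomorphicRepData`.
Theorems only (no definition, no named fact, no `sorry`).

`CuspidalCohomologyHeckeLocal` / `CuspidalCohomologyHeckeEigenvalue` prove, for a cuspidal `π` of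
`GL_n(𝔸_F)`, the PARALLEL-weight coefficients `E_wt(ℂ)` and a compact open level `U`, that the Hecke
operators `T_{w,j}` act on `H^q(𝔤, K_∞; π ⊗ E_wt(ℂ))^U` by the Satake scalars of `π` at all but
finitely many `w`.  THIS FILE is the same argument for the generic-coefficient Hecke module
`H^q(𝔤, K_∞; π ⊗ E)^U` of `AutomorphicCohomologyGLnCoeff` (`cohomologyGL`, `cohomologyGLRep`,
`cohomologyGLLevel`, `heckeTGL`; `E = (σK, σ𝔤)` ANY coefficient `(𝔤, K_∞)`-module, e.g. the
general-weight modules `E_λ` and their sign twists `E_λ ⊗ ε_S` of the realisation of cusp forms in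
the cohomology of `Res_{F/ℚ} GL_n`, `ResGLnCohomology.cuspidalEigenclass_exists`) and `π = W / W'` ANY
automorphic representation of `GL_n(𝔸_F)` in the Borel–Jacquet model, at the principal level
`K_f(𝔫)` and at EVERY place `w ∤ 𝔫`:

* `heckeTGL_eq_sum_local` — at a place where `U` is unramified, `T_{w,j} ξ = ∑_{y ∈ s} r(ι_w y) ξ`
  over a transversal `s` of `GL_n(𝒪_w) t_j GL_n(𝒪_w) / GL_n(𝒪_w)` [cite: KhareThorne2017, §6.2];
* `cohomologyGLRep_ofLocal` — `r(ι_w y)` acts on `H^q(𝔤, K_∞; π ⊗ E)` by `H^q(r(ι_w y) ⊗ 1)`;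
* `heckeTGL_eq_rTensorCohomologyHom_sum` — hence `T_{w,j} ξ = H^q(A ⊗ 1) ξ`,
  `A = ∑_{y ∈ s} r(ι_w y)` on `W / W'` [cite: BorelWallach2000, I §5.1];
* `exists_hasSatakeParamAt_heckeTGL_eq_smul` — **for `𝔫 ≠ 0`, a `K(𝔫)`-fixed form `φ ∈ W ∖ W'`,
  `E` finite-dimensional and EVERY `w ∤ 𝔫`: `π` has a Satake parameter `α_w` at `w` and
  `T_{w,j} ξ = q_w^{j(n−j)/2} e_j(α_w) • ξ` for all `j ≤ n` and all `K_f(𝔫)`-invariant classes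
  `ξ ∈ H^q(𝔤, K_∞; π ⊗ E)^{K_f(𝔫)}`** (hypothesis `hS`: the tree's per-`π` Flath statement
  `Flath1979_heckeOperator_ofLocal_sub_smul_mem`, a theorem of the tree,
  `Flath1979_heckeOperator_ofLocal_sub_smul_mem_holds` of `AutomorphicRepsGLSatakeFlathProofs`):
  `A` is the Satake scalar modulo `W'` on the `K(𝔫)`-invariant forms
  (`exists_hasSatakeParamAt_and_sum_rightTranslation_sub_smul_mem_of_sub_mem`) and `H^q(A ⊗ 1)` is
  that scalar on `K_f(𝔫)`-invariant classes (`rTensorCohomologyHom_eq_smul_of_forall_fixed`)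
  [cite: Harder1987, §3] [cite: FlathCorvallis1979, Thm. 3] [cite: Clozel1990, §3.5 (p. 123)].

This is the cohomological half of the Hecke-equivariance clause of the Eichler–Shimura–Borel
realisation (`ResGLnCohomology.cuspidalEigenclass_exists_of_eigenformComparison`): together with an
equivariant map `H^q(𝔤, K_∞; π ⊗ E_λ ⊗ ε_S)^{K_f(𝔫)} → H^q(S_{K_f(𝔫)}, Ẽ_λ)` non-zero on some
invariant class it yields the eigenclass (`ResGLnCuspidalEigenclassOfRealisation`).

## References
* [Harder1987] G. Harder, *Eisenstein cohomology of arithmetic groups. The case GL₂*, Invent. math. 89 (1987), §3.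
* [KhareThorne2017] C. Khare, J. Thorne, Amer. J. Math. 139 (2017), §6.2.
* [FlathCorvallis1979] D. Flath, *Decomposition of representations into tensor products*, Corvallis 1979, Thm. 3.
* [BorelWallach2000] A. Borel, N. Wallach, 2nd ed. (2000), I §5.1, VII §2.
* [Clozel1990] L. Clozel, *Motifs et formes automorphes* (1990), §3.5 (p. 123).
-/

noncomputable section

namespace Literature.NumberTheory.Automorphic

open Module Literature.Algebra.Lie
open scoped TensorProduct

-- Mathlib idiom (as in `GKModules`): commutator bracket on `Module.End`
attribute [local instance 100] LieRing.ofAssociativeRing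

namespace AutomorphicRepData

open RealMatrixGroup MulAction IsDedekindDomain CuspidalAutomorphicRepData
open scoped MatrixGroups Classical
open scoped _root_.NumberField
open _root_.NumberField

variable {F : Type} [Field F] [NumberField F] {n : ℕ} {hcpt : isCompact_glFiniteIntegralLevel n F}
  (π : AutomorphicRepData (AutomorphyDatum.gl n F hcpt))
  {E : Type*} [AddCommGroup E] [Module ℂ E]
  (σK : Representation ℂ (archGroupGL n F).maximalCompact E)
  (σ𝔤 : (archGroupGL n F).lie →ₗ⁅ℝ⁆ Module.End ℂ E)
  (hE : ∀ (k : (archGroupGL n F).maximalCompact) (X : (archGroupGL n F).lie),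
    σK k ∘ₗ σ𝔤 X ∘ₗ σK k⁻¹ =
      σ𝔤 ((archGroupGL n F).Ad (Subgroup.inclusion (archGroupGL n F).maximalCompact_le_carrier k) X))
  (U : Subgroup (BigHeckeGLn.FiniteAdelicGL n F))

/-- **`T_{w,j}` at a good place is the local double-coset sum** on `U`-invariant classes of
`H^q(𝔤, K_∞; π ⊗ E)`: `T_{w,j} ξ = ∑_{y ∈ s} r(ι_w y) ξ` for a transversal `s` of
`GL_n(𝒪_w) t GL_n(𝒪_w) / GL_n(𝒪_w)`, `ι_w(t) = t_{w,j}`, when `U` is unramified at `w`.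
[cite: KhareThorne2017, §6.2] -/
theorem heckeTGL_eq_sum_local (q : ℕ) (w : HeightOneSpectrum (𝓞 F)) (j : ℕ)
    (hU : ArithmeticQuotient.IsUnramifiedLevel
      (valuedCongruenceSubgroup (Fin n) (1 : WithZero (Multiplicative ℤ)))
      (BigHeckeGLn.ofLocal n F w) (BigHeckeGLn.localComponent n F w) U)
    (t : GL (Fin n) (w.adicCompletion F))
    (ht : BigHeckeGLn.ofLocal n F w t = BigHeckeGLn.heckeElement n F w j)
    (s : Finset (GL (Fin n) (w.adicCompletion F)))
    (hs : Set.BijOn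
      (fun y : GL (Fin n) (w.adicCompletion F) =>
        (y : GL (Fin n) (w.adicCompletion F) ⧸
          valuedCongruenceSubgroup (Fin n) (1 : WithZero (Multiplicative ℤ))))
      s (orbit (valuedCongruenceSubgroup (Fin n) (1 : WithZero (Multiplicative ℤ)) :
          Subgroup (GL (Fin n) (w.adicCompletion F)))
        (t : GL (Fin n) (w.adicCompletion F) ⧸
          (valuedCongruenceSubgroup (Fin n) (1 : WithZero (Multiplicative ℤ)) :
            Subgroup (GL (Fin n) (w.adicCompletion F))))))
    {ξ : π.cohomologyGL σK σ𝔤 hE q} (hξ : ξ ∈ π.cohomologyGLLevel σK σ𝔤 hE U q) :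
    π.heckeTGL σK σ𝔤 hE U q w j ξ =
      ∑ y ∈ s, π.cohomologyGLRep σK σ𝔤 hE q (BigHeckeGLn.ofLocal n F w y) ξ := by
  have key := hU.heckeOperator_apply_eq_sum_local (π.cohomologyGLRep σK σ𝔤 hE q) t s hs hξ
  have e : heckeOperator (π.cohomologyGLRep σK σ𝔤 hE q) U (BigHeckeGLn.heckeElement n F w j) =
      heckeOperator (π.cohomologyGLRep σK σ𝔤 hE q) U (BigHeckeGLn.ofLocal n F w t) :=
    congrArg (heckeOperator (π.cohomologyGLRep σK σ𝔤 hE q) U) ht.symm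
  exact (LinearMap.congr_fun e ξ).trans key

/-- **The action of `ι_w(y)` on `H^q(𝔤, K_∞; π ⊗ E)` is `H^q(r(ι_w y) ⊗ 1)`.** [folklore] -/
theorem cohomologyGLRep_ofLocal (q : ℕ) (w : HeightOneSpectrum (𝓞 F))
    (y : GL (Fin n) (w.adicCompletion F)) :
    π.cohomologyGLRep σK σ𝔤 hE q (BigHeckeGLn.ofLocal n F w y) =
      GKTensor.rTensorCohomologyHom (archGroupGL n F) π.kRep π.lieRep σK σ𝔤
        (π.isGKModule_of_hasLieAction_holds (AutomorphyDatum.isRegular_gl hcpt)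
          π.hasLieAction_lieRep).ad_compat hE
        (π.finiteRep ⟨GLn.ofLocal n F w y, ofLocal_mem_finiteAdelic (hcpt := hcpt) w y⟩)
        (fun X => π.finiteRep_comm_of_hasLieAction π.hasLieAction_lieRep _ X)
        (fun k => π.finiteRep_comm_kRep _ k) q := by
  have h : (⟨GLn.ofFinite n F (BigHeckeGLn.ofLocal n F w y), BigHeckeGLn.ofLocal n F w y, rfl⟩ :
      (AutomorphyDatum.gl n F hcpt).finiteAdelic) =
      ⟨GLn.ofLocal n F w y, ofLocal_mem_finiteAdelic (hcpt := hcpt) w y⟩ :=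
    Subtype.ext (GLn.ofFinite_sndHom_ofLocal w y)
  rw [cohomologyGLRep_apply]
  unfold cohomologyGLRepRange AutomorphicRepData.cohomologyRepWith
  rw [GKTensor.cohomologyRep_apply_eq]
  exact GKTensor.rTensorCohomologyHom_congr (archGroupGL n F) π.kRep π.lieRep σK σ𝔤 _ _
    (congrArg π.finiteRep h) _ _ _ _ q

/-- **`T_{w,j}` at a good place is `H^q` of the sum of translations** `A = ∑_{y ∈ s} r(ι_w y)` on
`π = W / W'`, tensored with `E`. [cite: KhareThorne2017, §6.2] [cite: BorelWallach2000, I §5.1] -/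
theorem heckeTGL_eq_rTensorCohomologyHom_sum (q : ℕ) (w : HeightOneSpectrum (𝓞 F)) (j : ℕ)
    (hU : ArithmeticQuotient.IsUnramifiedLevel
      (valuedCongruenceSubgroup (Fin n) (1 : WithZero (Multiplicative ℤ)))
      (BigHeckeGLn.ofLocal n F w) (BigHeckeGLn.localComponent n F w) U)
    (t : GL (Fin n) (w.adicCompletion F))
    (ht : BigHeckeGLn.ofLocal n F w t = BigHeckeGLn.heckeElement n F w j)
    (s : Finset (GL (Fin n) (w.adicCompletion F)))
    (hs : Set.BijOn
      (fun y : GL (Fin n) (w.adicCompletion F) =>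
        (y : GL (Fin n) (w.adicCompletion F) ⧸
          valuedCongruenceSubgroup (Fin n) (1 : WithZero (Multiplicative ℤ))))
      s (orbit (valuedCongruenceSubgroup (Fin n) (1 : WithZero (Multiplicative ℤ)) :
          Subgroup (GL (Fin n) (w.adicCompletion F)))
        (t : GL (Fin n) (w.adicCompletion F) ⧸
          (valuedCongruenceSubgroup (Fin n) (1 : WithZero (Multiplicative ℤ)) :
            Subgroup (GL (Fin n) (w.adicCompletion F))))))
    {ξ : π.cohomologyGL σK σ𝔤 hE q} (hξ : ξ ∈ π.cohomologyGLLevel σK σ𝔤 hE U q) :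
    π.heckeTGL σK σ𝔤 hE U q w j ξ =
      GKTensor.rTensorCohomologyHom (archGroupGL n F) π.kRep π.lieRep σK σ𝔤
        (π.isGKModule_of_hasLieAction_holds (AutomorphyDatum.isRegular_gl hcpt)
          π.hasLieAction_lieRep).ad_compat hE
        (∑ y ∈ s, π.finiteRep ⟨GLn.ofLocal n F w y, ofLocal_mem_finiteAdelic (hcpt := hcpt) w y⟩)
        (sum_comm𝔤 (archGroupGL n F) π.lieRep π.lieRep s _
          fun _ X => π.finiteRep_comm_of_hasLieAction π.hasLieAction_lieRep _ X)
        (sum_commK (archGroupGL n F) π.kRep π.kRep s _ fun _ k => π.finiteRep_comm_kRep _ k)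
        q ξ := by
  rw [π.heckeTGL_eq_sum_local σK σ𝔤 hE U q w j hU t ht s hs hξ]
  simp only [cohomologyGLRep_ofLocal]
  exact GKTensor.sum_rTensorCohomologyHom (archGroupGL n F) π.kRep π.lieRep σK σ𝔤 _ _ s _ _ _ q ξ

set_option maxHeartbeats 800000 in
/-- **Hecke operators act on `H^q(𝔤, K_∞; π ⊗ E)^{K_f(𝔫)}` by the Satake scalars at EVERY
`w ∤ 𝔫`.**  For `π = W / W'` on `GL_n(𝔸_F)` satisfying the tree's per-`π` Flath statement
(hypothesis `hS`, a theorem of the tree: `Flath1979_heckeOperator_ofLocal_sub_smul_mem_holds`), a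
level `𝔫 ≠ 0` with a `K(𝔫)`-fixed form `φ ∈ W ∖ W'`, a finite-dimensional coefficient
`(𝔤, K_∞)`-module `E` and a place `w ∤ 𝔫`: `π` has a Satake parameter `α_w` at `w` and, for all
`j ≤ n` and all `K_f(𝔫)`-invariant classes `ξ`, `T_{w,j} ξ = q_w^{j(n−j)/2} e_j(α_w) • ξ`
(`K_f(𝔫) = finitePrincipalCongruenceLevel n F 𝔫`).  Assembly of: `K_f(𝔫)` is unramified at `w`
(`BigHeckeGLn.isUnramifiedLevel_comap_principalCongruenceLevel`); `T_{w,j} = H^q(A ⊗ 1)`,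
`A = ∑_y r(ι_w y)` (`heckeTGL_eq_rTensorCohomologyHom_sum`); `A` is the Satake scalar modulo `W'` on
the `K(𝔫)`-invariant forms (`exists_hasSatakeParamAt_and_sum_rightTranslation_sub_smul_mem_of_sub_mem`);
and `H^q(A ⊗ 1)` is that scalar on `K_f(𝔫)`-invariant classes
(`rTensorCohomologyHom_eq_smul_of_forall_fixed`). [cite: Harder1987, §3] [cite: FlathCorvallis1979, Thm. 3]
[cite: BorelWallach2000, I §5.1] [cite: Clozel1990, §3.5 (p. 123)] -/
theorem exists_hasSatakeParamAt_heckeTGL_eq_smul [FiniteDimensional ℂ E]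
    (hS : π.Flath1979_heckeOperator_ofLocal_sub_smul_mem) {𝔫 : Ideal (𝓞 F)} (h𝔫 : 𝔫 ≠ 0)
    {φ : (AdelicGroupData.gl n F).Adelic → ℂ} (hφW : φ ∈ π.W) (hφW' : φ ∉ π.W')
    (hfixφ : ∀ u ∈ principalCongruenceLevel n F 𝔫, rightTranslation (AdelicGroupData.gl n F) u φ = φ)
    (q : ℕ) {w : HeightOneSpectrum (𝓞 F)} (hw : ¬ w.asIdeal ∣ 𝔫) :
    ∃ α : Multiset ℂ, π.HasSatakeParamAt w α ∧ ∀ j ≤ n,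
      ∀ ξ ∈ π.cohomologyGLLevel σK σ𝔤 hE (finitePrincipalCongruenceLevel n F 𝔫) q,
        π.heckeTGL σK σ𝔤 hE (finitePrincipalCongruenceLevel n F 𝔫) q w j ξ =
          ((((Real.sqrt (w.residueCard : ℝ) : ℝ) : ℂ) ^ (j * (n - j)) * α.esymm j)) • ξ := by
  classical
  obtain ⟨α, hα, hmod⟩ :=
    π.exists_hasSatakeParamAt_and_sum_rightTranslation_sub_smul_mem_of_sub_mem hS h𝔫 hw
      hφW hφW' hfixφ
  refine ⟨α, hα, fun j hj ξ hξ => ?_⟩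
  -- local data at `w`: `ι_w(t_j) = T_{w,j}`, a transversal of the finite `K_w t_j K_w / K_w`
  have ht := (BigHeckeGLn.heckeElement_eq_ofLocal (n := n) (K := F) w j).symm
  haveI := isHeckeTriple_top_of_isCompact_isOpen _
    (isCompact_valuedCongruenceSubgroup_one n F w) (isOpen_valuedCongruenceSubgroup_one n F w)
  have hfin := finite_orbit_quotient
    (K := (valuedCongruenceSubgroup (Fin n) (1 : WithZero (Multiplicative ℤ)) :
      Subgroup (GL (Fin n) (w.adicCompletion F))))
    (glDiagonal n (w.adicCompletion F) fun l => if l.val < j then BigHeckeGLn.uniformizerAt w else 1)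
  obtain ⟨s, hs⟩ := ArithmeticQuotient.IsUnramifiedLevel.exists_transversal
    (Kᵥ := (valuedCongruenceSubgroup (Fin n) (1 : WithZero (Multiplicative ℤ)) :
      Subgroup (GL (Fin n) (w.adicCompletion F)))) _ hfin
  have hunr := BigHeckeGLn.isUnramifiedLevel_comap_principalCongruenceLevel (n := n) (K := F) h𝔫 hw
  rw [π.heckeTGL_eq_rTensorCohomologyHom_sum σK σ𝔤 hE (finitePrincipalCongruenceLevel n F 𝔫) q w j
    hunr _ ht s hs hξ]
  refine π.rTensorCohomologyHom_eq_smul_of_forall_fixed σK σ𝔤 hE (AutomorphyDatum.isRegular_gl hcpt)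
    π.hasLieAction_lieRep q
    ((principalCongruenceLevel n F 𝔫).comap (AutomorphyDatum.gl n F hcpt).finiteAdelic.subtype)
    (isCompact_comap_subtype_principalCongruenceLevel (hcpt := hcpt) h𝔫) _ _ _ _
    (fun x hx => ?_) (fun u hu => ?_)
  · -- `A = c` on the `K_f(𝔫)`-invariant vectors of `π = W / W'`
    obtain ⟨ψ, rfl⟩ := Submodule.Quotient.mk_surjective π.kerQuot x
    have hψ : ∀ u ∈ principalCongruenceLevel n F 𝔫,
        rightTranslation (AdelicGroupData.gl n F) u ψ - ψ ∈ π.W' := by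
      intro u hu
      have hu' : GLn.ofFinite n F (GLn.sndHom n F u) = u :=
        GLn.ofFinite_sndHom_of_mem (principalCongruenceLevel_le n F _ hu)
      have hmem : (⟨u, GLn.sndHom n F u, hu'⟩ : (AutomorphyDatum.gl n F hcpt).finiteAdelic) ∈
          (principalCongruenceLevel n F 𝔫).comap
            (AutomorphyDatum.gl n F hcpt).finiteAdelic.subtype := by
        rw [Subgroup.mem_comap, Subgroup.coe_subtype]
        exact hu
      have h := hx _ hmem
      rw [AutomorphicRepData.finiteRep_mk, Submodule.Quotient.eq] at h
      simpa only [AutomorphicRepData.kerQuot, Submodule.mem_comap, Submodule.coe_subtype,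
        Submodule.coe_sub] using h
    have key := hmod j hj s hs ψ ψ.2 hψ
    have hterm : ∀ y ∈ s,
        π.finiteRep ⟨GLn.ofLocal n F w y, ofLocal_mem_finiteAdelic (hcpt := hcpt) w y⟩
          (Submodule.Quotient.mk ψ) =
        π.kerQuot.mkQ (π.finiteRepW
          ⟨GLn.ofLocal n F w y, ofLocal_mem_finiteAdelic (hcpt := hcpt) w y⟩ ψ) := fun y _ => rfl
    have hsmul : ((((Real.sqrt (w.residueCard : ℝ) : ℝ) : ℂ) ^ (j * (n - j)) * α.esymm j)) •
        (Submodule.Quotient.mk ψ : π.Quot) =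
        π.kerQuot.mkQ (((((Real.sqrt (w.residueCard : ℝ) : ℝ) : ℂ) ^ (j * (n - j)) *
          α.esymm j)) • ψ) := rfl
    rw [LinearMap.sum_apply, Finset.sum_congr rfl hterm, ← map_sum, hsmul, ← sub_eq_zero,
      ← map_sub, Submodule.mkQ_apply, Submodule.Quotient.mk_eq_zero]
    simp only [AutomorphicRepData.kerQuot, Submodule.mem_comap, Submodule.coe_subtype,
      Submodule.coe_sub, Submodule.coe_smul, AddSubmonoidClass.coe_finsetSum]
    exact key
  · -- `K_f(𝔫)`-invariance of `ξ`
    obtain ⟨g, u₀, rfl⟩ := u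
    rw [Subgroup.mem_comap, Subgroup.coe_subtype] at hu
    have hgU : u₀ ∈ finitePrincipalCongruenceLevel n F 𝔫 := by
      show u₀ ∈ (principalCongruenceLevel n F 𝔫).comap (GLn.ofFinite n F)
      rw [Subgroup.mem_comap]
      exact hu
    have h := (Representation.mem_fixedPoints _ _ _).1 hξ u₀ hgU
    rw [cohomologyGLRep_apply] at h
    unfold cohomologyGLRepRange at h
    exact h

end AutomorphicRepData

end Literature.NumberTheory.Automorphic

end
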